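import Summits.QuantumFields.YangMills.Theses.InfiniteVolumeContinuum
import Summits.QuantumFields.YangMills.Theorems.BalabanLadderInfVolRPSeries
import HarnessLib

/-!
# Route `InfiniteVolumeContinuum`, support item `IVReflectionPositivity` (stmt-QuantumFields-19932): PROVED

HONEST FRAMING (R136 (i) «infinite-volume ∕ continuum-from-UV», seat `ym-infvol-p3`): the route is CONDITIONAL on
Track A's UV Prop (`BalabanLadder.UV`, by name) and delivers the EXISTENCE half only (OS0–OS3 of a continuum limit;
no clustering, no mass gap, not Clay). This file closes the route's E2 support item
`Summit.QuantumFields.YangMills.Theses.InfiniteVolumeContinuum.IVReflectionPositivity` UNCONDITIONALLY — reflection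
positivity of the infinite-volume-first continuum data is exact soft analysis and uses neither the UV Prop nor the
`MomentBounds6` binder of the item:

for every compact `G`, `r`, unit `a` (`0 < a`, `a → 0`) and every DATA tuple `(β, μ, S₁, T)` — couplings `β k → ∞`,
thermodynamic-limit states `μ k ∈ oddTorusLimitPoints r (β k)`, plane-string limits `T n q` of the centre-smeared
infinite-volume series `Σ'ₓ stateMomentStr G r (μ k) n q x · F(a(β k)•x + (a(β k)/2)•(e_{q.1} + e_{q.2}))` on `⁰𝒮`, and
the one-field family `S₁` assembled from them (`S₁ 0 = ev`, `S₁ 1 = 0`, `S₁ n = Σ_{q valid} T n q`) — `RPPos S₁` holds.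
(`G` is Hausdorff and second countable because `r.ρ` is a faithful continuous matrix representation of a compact group.)

Proof: `InfVolRP.rpPos_of_oddTorusLimitStates_centre` (Theorems/BalabanLadderInfVolRPSeries.lean, p459727; chain
p455552 → p457452 → p458657 → p459629 → p459727): every `μ k` is site-RP (GaugeBoot
`siteRP_zero_of_mem_infiniteVolumeLimitPoints`, `β k ≥ 0` eventually from `β k → ∞`), the lattice OS form of the
centre-smeared series is EXACTLY its RP square (`stateMomentStr_series_osForm_nonneg`), and positivity passes to the
limit on `⁰𝒮` (`rpPos_of_eventually_nonneg`); the item's evaluation points are `a • (siteToE x + centreOffset q)`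
written out (`centre_point_eq`).

References: K. Osterwalder, E. Seiler, Ann. Phys. 110 (1978) §2; K. Osterwalder, R. Schrader, CMP 31 (1973) §2 (E2),
CMP 42 (1975) §4; J. Glimm, A. Jaffe, Quantum Physics (1987) §6.1.
-/

noncomputable section

open scoped SchwartzMap BigOperators
open MeasureTheory Filter Topology
open Literature.MathematicalPhysics.QuantumFieldTheory Literature.MathematicalPhysics.QuantumLattice
open Literature.MathematicalPhysics.AQFT
open Literature.Probability.LatticeModels (Site)
open Summit.QuantumFields.YangMills.Theorems.InfiniteVolume (stateMomentStr)
open Summit.QuantumFields.YangMills.Theorems.InfVolRP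

namespace Summit.QuantumFields.YangMills.Theorems.InfiniteVolumeContinuum

/-- **The item's evaluation points are the plaquette-centre points of the toolkit**: for a valid orientation
`q.1 < q.2`, `a • (siteToE x + centreOffset q) = a • siteToE x + (a/2) • (e_{q.1} + e_{q.2})`. [folklore] -/
theorem centre_point_eq (a : ℝ) {q : Fin 4 × Fin 4} (hq : q.1 < q.2) (x : Site 4) :
    a • (siteToE x + centreOffset q) =
      a • siteToE x + (a / 2) • (EuclideanSpace.single q.1 (1 : ℝ) + EuclideanSpace.single q.2 (1 : ℝ)) := by
  unfold centreOffset
  rw [if_pos hq, smul_add, smul_smul, mul_one_div]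

/-- **Support item `IVReflectionPositivity` (stmt-QuantumFields-19932) of route `InfiniteVolumeContinuum`, proved**:
E2 (`RPPos`) of the infinite-volume-first continuum data, for every DATA tuple, by the exact lattice reflection
positivity of the centre-smeared plane-string series of thermodynamic-limit states and inheritance along the limit
(`InfVolRP.rpPos_of_oddTorusLimitStates_centre`). The binders `MomentBounds6 G r a` and `Tendsto a atTop (𝓝 0)` of
the item are not needed beyond `a ∘ β → 0`. -/
theorem IVReflectionPositivity_holds :
    Summit.QuantumFields.YangMills.Theses.InfiniteVolumeContinuum.IVReflectionPositivity := by
  unfold Summit.QuantumFields.YangMills.Theses.InfiniteVolumeContinuum.IVReflectionPositivity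
  intro G _ _ _ _ _ _ r a β μ S₁ T ha ha0 _ hD
  obtain ⟨hβ, hμ, h0, h1, hsum, hconv⟩ := hD
  -- a faithful continuous matrix representation of the compact group makes it Hausdorff and second countable
  haveI : T2Space G := (r.continuous.isClosedEmbedding r.injective).isEmbedding.t2Space
  haveI : SecondCountableTopology G :=
    (r.continuous.isClosedEmbedding r.injective).isEmbedding.secondCountableTopology
  have hβev : ∀ᶠ k in atTop, 0 ≤ β k := hβ.eventually_ge_atTop 0
  refine (rpPos_of_oddTorusLimitStates_centre r hβev μ hμ (fun k => ha (β k)) (ha0.comp hβ) T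
    (fun n hn q hq F hF => ?_) S₁ hsum h0 h1).1
  have hpt : ∀ (k : ℕ) (x : Fin n → Site 4),
      (fun l => a (β k) • (siteToE (x l) + centreOffset (q l))) =
        fun l => a (β k) • siteToE (x l) +
          (a (β k) / 2) • (EuclideanSpace.single (q l).1 (1 : ℝ) + EuclideanSpace.single (q l).2 (1 : ℝ)) :=
    fun k x => funext fun l => centre_point_eq (a (β k)) (hq l) (x l)
  simp_rw [hpt]
  exact hconv n hn q hq F hF

end Summit.QuantumFields.YangMills.Theorems.InfiniteVolumeContinuum

end
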